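import Literature.Probability.RandomPlanarGeometry.SAWBridgeTwoStepRate
import Mathlib.Analysis.SpecialFunctions.Pow.Real
import HarnessLib

/-!
# Kesten's ratio-rate engines, generalised: upper envelope `a_n ≤ e^{c'√n} μ^n` and MIXED
# supermultiplicativity `b₀(m) a(n) ≤ a(m+n)` (real sequences; no self-avoiding-walk content)

Topic `Literature/Probability/RandomPlanarGeometry`, next to `SAWBridgeTwoStepRate.lean`, whose two real-sequence
routines (`Zd.upper_rate_core`: a Kesten inequality `φ_n − D/n ≤ φ_{n+2}`, `φ_n = a_{n+2}/a_n`, plus the envelopes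
`e^{-c√n} μ^n ≤ a_n ≤ μ^n` force `u N^{1/4} ≤ K` for a deviation `φ_N ≥ μ² + u`; `Zd.lower_rate_core`: plus
supermultiplicativity `a_m a_n ≤ a_{m+n}` force `v³ N ≤ K` for `φ_N ≤ μ² − v`) are the quantitative form of
Madras–Slade Lemma 7.3.1 (Kesten 1963). Here (lane pcv-sawmu, planner route R27 "engine generalisations"; not in
print as such): the SAME two routines under WEAKER hypotheses — upper envelope `a_n ≤ e^{c'√n} μ^n` (any
`c' ≥ 0`; the constant becomes `c'' = c + c'√(1+μ²)`, deviations `u ≤ μ²`), and the lower routine with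
`b₀(m) · a(n) ≤ a(m+n)` for an auxiliary sequence `b₀` carrying the lower envelope `e^{-c√n} μ^n ≤ b₀(n)` — exactly
what the half-space counts `a = h`, `b₀ = b` satisfy (`SAWHalfSpaceTwoStepRate.lean`). AXIOMS: standard.

Source anchor: N. Madras, G. Slade (1993), Lemma 7.3.1 (book p. 243) and its proof (the iteration (7.3.3) and the
contradiction with `a_N^{1/N} → μ`); §7.5 eq. (7.5.2) for the exponents `1/3`, `1/4`.

## Contents (namespace `Literature.Probability.RandomPlanarGeometry.SAW.Zd`), all PROVED, no definitions
* `upper_dev_env₂` — `M log(1 + u/(2μ²)) ≤ c√N + c'√(N+2M)`;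
* **`upper_rate_core_env`** — `u N^{1/4} ≤ √(8μ²D(c''+1)) + 2D(2c''+1)`, `c'' = c + c'√(1+μ²)` (`0 < u ≤ μ²`);
* `lower_dev_mixed` — `−M log(1 − u/(2μ²)) ≤ c√(2M)`;
* **`lower_rate_core_mixed`** — `v³ N ≤ 32c²μ⁴D + 4D³` (`0 < v ≤ min(μ², D)`, `N ≥ 2N₁ + 2`).
-/

noncomputable section

open Filter Topology Finset Literature.Probability.LatticeModels Literature.Probability.Percolation SimpleGraph
open scoped BigOperators

namespace Literature.Probability.RandomPlanarGeometry.SAW.Zd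

/-- `-log(1 - x) ≥ x` for `x < 1`. [folklore] -/
private theorem le_neg_log_one_sub' {x : ℝ} (hx : x < 1) : x ≤ -Real.log (1 - x) := by
  have h := Real.add_one_le_exp (-x)
  have h1 : 0 < 1 - x := by linarith
  have h2 := Real.log_le_log h1 (by linarith : 1 - x ≤ Real.exp (-x))
  rw [Real.log_exp] at h2; linarith

/-- `log(1 + x) ≥ x/2` on `[0, 1]`. [folklore] -/
private theorem half_le_log_one_add' {x : ℝ} (hx0 : 0 ≤ x) (hx1 : x ≤ 1) : x / 2 ≤ Real.log (1 + x) := by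
  have h := Real.add_one_le_exp (-(Real.log (1 + x)))
  rw [Real.exp_neg, Real.exp_log (by linarith)] at h
  have h1 : x / (1 + x) ≤ Real.log (1 + x) := by
    rw [div_le_iff₀ (by linarith)]
    have : (1 - Real.log (1 + x)) * (1 + x) ≤ 1 := by
      calc (1 - Real.log (1 + x)) * (1 + x) = (-Real.log (1 + x) + 1) * (1 + x) := by ring
        _ ≤ (1 + x)⁻¹ * (1 + x) := mul_le_mul_of_nonneg_right h (by linarith)
        _ = 1 := inv_mul_cancel₀ (by linarith)
    nlinarith
  have h2 : x / 2 ≤ x / (1 + x) := div_le_div_of_nonneg_left hx0 (by linarith) (by linarith)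
  linarith

/-! ### The upper routine with a sub-exponential upper envelope -/

/-- **Upper deviation with the two envelopes**: if `φ_N ≥ μ² + u` (`N ≥ N₁`, `N ≥ 1`) and `M·D ≤ uN/2` then
`(μ² + u/2)^M e^{-c√N} μ^N ≤ a_{N+2M} ≤ e^{c'√(N+2M)} μ^{N+2M}`: `M log(1 + u/(2μ²)) ≤ c√N + c'√(N+2M)`.
[cite: MadrasSlade1993, Lemma 7.3.1 (proof, quantitative form)] -/
theorem upper_dev_env₂ {b : ℕ → ℝ} {μ D c c' u : ℝ} {N₁ N M : ℕ} (hb : ∀ n, 0 < b n) (hμ : 0 < μ)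
    (hD : 0 ≤ D) (hK : ∀ n : ℕ, N₁ ≤ n → b (n + 2) / b n - D / n ≤ b (n + 4) / b (n + 2))
    (hhi : ∀ n : ℕ, b n ≤ Real.exp (c' * Real.sqrt n) * μ ^ n)
    (hlo : Real.exp (-(c * Real.sqrt N)) * μ ^ N ≤ b N)
    (hN : N₁ ≤ N) (hN1 : 1 ≤ N) (hu : 0 < u) (hdev : μ ^ 2 + u ≤ b (N + 2) / b N)
    (hM : (M : ℝ) * D ≤ u * N / 2) :
    (M : ℝ) * Real.log (1 + u / (2 * μ ^ 2)) ≤ c * Real.sqrt N + c' * Real.sqrt ((N + 2 * M : ℕ) : ℝ) := by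
  have hN0 : (0 : ℝ) < N := by exact_mod_cast hN1
  set q : ℝ := μ ^ 2 + u / 2 with hq
  have hq0 : 0 ≤ q := by positivity
  have hK' : ∀ n : ℕ, N₁ ≤ n → (fun n => b (n + 2) / b n) n - D / n ≤ (fun n => b (n + 2) / b n) (n + 2) := by
    intro n hn; simpa [add_assoc] using hK n hn
  have hiter := kesten_iter_forward (φ := fun n => b (n + 2) / b n) (N₁ := N₁) hD hK' hN hN1
  have hstep : ∀ k < M, q ≤ b (N + 2 * k + 2) / b (N + 2 * k) := by
    intro k hk
    have h1 := hiter k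
    have h2 : (k : ℝ) * D / N ≤ u / 2 := by
      rw [div_le_iff₀ hN0]
      have : (k : ℝ) * D ≤ M * D := mul_le_mul_of_nonneg_right (by exact_mod_cast hk.le) hD
      linarith
    have e : b (N + 2 * k + 2) / b (N + 2 * k) = (fun n => b (n + 2) / b n) (N + 2 * k) := rfl
    rw [e]
    linarith
  have hprod := kesten_prod_ge hb (n := N) (M := M) hq0 hstep
  set E : ℝ := Real.exp (c' * Real.sqrt ((N + 2 * M : ℕ) : ℝ)) with hE
  have hE0 : 0 < E := Real.exp_pos _
  have h1 : q ^ M * (Real.exp (-(c * Real.sqrt N)) * μ ^ N) ≤ E * μ ^ (N + 2 * M) :=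
    calc q ^ M * (Real.exp (-(c * Real.sqrt N)) * μ ^ N) ≤ q ^ M * b N :=
          mul_le_mul_of_nonneg_left hlo (pow_nonneg hq0 M)
      _ ≤ b (N + 2 * M) := hprod
      _ ≤ E * μ ^ (N + 2 * M) := hhi _
  have h2 : (q / μ ^ 2) ^ M ≤ Real.exp (c * Real.sqrt N) * E := by
    rw [div_pow, div_le_iff₀ (by positivity), ← pow_mul]
    have e : μ ^ (N + 2 * M) = μ ^ (2 * M) * μ ^ N := by rw [pow_add, mul_comm]
    rw [e] at h1
    have h1' : q ^ M * Real.exp (-(c * Real.sqrt N)) * μ ^ N ≤ E * μ ^ (2 * M) * μ ^ N := by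
      rw [mul_assoc, mul_assoc]; simpa [mul_assoc] using h1
    have h3 := le_of_mul_le_mul_right h1' (pow_pos hμ N)
    rw [Real.exp_neg] at h3
    rw [← div_eq_mul_inv, div_le_iff₀ (Real.exp_pos _)] at h3
    calc q ^ M ≤ E * μ ^ (2 * M) * Real.exp (c * Real.sqrt N) := h3
      _ = Real.exp (c * Real.sqrt N) * E * μ ^ (2 * M) := by ring
  have hr : q / μ ^ 2 = 1 + u / (2 * μ ^ 2) := by rw [hq]; field_simp
  have hr0 : 0 < q / μ ^ 2 := by rw [hr]; positivity
  have h3 := Real.log_le_log (pow_pos hr0 M) h2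
  rw [Real.log_pow, hr, Real.log_mul (Real.exp_pos _).ne' hE0.ne', Real.log_exp, hE, Real.log_exp] at h3
  exact h3

/-- **Upper routine with the envelope `a_n ≤ e^{c'√n} μ^n`**: a deviation `φ_N ≥ μ² + u` with `0 < u ≤ μ²`
(`N ≥ max(N₁, 1)`, `D ≥ 1`) forces `u · N^{1/4} ≤ √(8 μ² D (c''+1)) + 2D(2c''+1)` with `c'' = c + c'√(1+μ²)`
(`M ≤ uN/(2D) ≤ μ²N/2`, so `√(N+2M) ≤ √(1+μ²)·√N`). [cite: MadrasSlade1993, Lemma 7.3.1 (proof, quantitative form)] -/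
theorem upper_rate_core_env {b : ℕ → ℝ} {μ D c c' u : ℝ} {N₁ N : ℕ} (hb : ∀ n, 0 < b n) (hμ : 0 < μ)
    (hD1 : 1 ≤ D) (hc0 : 0 ≤ c) (hc'0 : 0 ≤ c')
    (hK : ∀ n : ℕ, N₁ ≤ n → b (n + 2) / b n - D / n ≤ b (n + 4) / b (n + 2))
    (hhi : ∀ n : ℕ, b n ≤ Real.exp (c' * Real.sqrt n) * μ ^ n)
    (hlo : ∀ n : ℕ, Real.exp (-(c * Real.sqrt n)) * μ ^ n ≤ b n)
    (hN : N₁ ≤ N) (hN1 : 1 ≤ N) (hu : 0 < u) (huμ : u ≤ μ ^ 2) (hdev : μ ^ 2 + u ≤ b (N + 2) / b N) :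
    u * (N : ℝ) ^ ((1 : ℝ) / 4) ≤
      Real.sqrt (8 * μ ^ 2 * D * ((c + c' * Real.sqrt (1 + μ ^ 2)) + 1)) +
        2 * D * (2 * (c + c' * Real.sqrt (1 + μ ^ 2)) + 1) := by
  have hD : 0 ≤ D := by linarith
  have hD0 : 0 < D := by linarith
  have hNr : (1 : ℝ) ≤ N := by exact_mod_cast hN1
  have hN0 : (0 : ℝ) < N := by linarith
  set c'' : ℝ := c + c' * Real.sqrt (1 + μ ^ 2) with hc''
  have hc''0 : 0 ≤ c'' := by positivity
  obtain ⟨M, hMdef⟩ : ∃ M : ℕ, M = Nat.floor (u * N / (2 * D)) := ⟨_, rfl⟩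
  have hMle : (M : ℝ) ≤ u * N / (2 * D) := by rw [hMdef]; exact Nat.floor_le (by positivity)
  have hMge : u * N / (2 * D) - 1 ≤ M := by
    have := Nat.lt_floor_add_one (u * N / (2 * D)); rw [← hMdef] at this; linarith
  have hMD : (M : ℝ) * D ≤ u * N / 2 := by
    have h1 : (M : ℝ) * (2 * D) ≤ u * N := by rwa [le_div_iff₀ (by positivity)] at hMle
    linarith
  have hlem0 := upper_dev_env₂ (N₁ := N₁) hb hμ hD hK hhi (hlo N) hN hN1 hu hdev hMD
  -- `√(N + 2M) ≤ √(1+μ²) √N`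
  have hM2 : 2 * (M : ℝ) ≤ μ ^ 2 * N := by
    have h1 : (M : ℝ) * (2 * D) ≤ u * N := by rwa [le_div_iff₀ (by positivity)] at hMle
    have hM0 : (0 : ℝ) ≤ M := Nat.cast_nonneg M
    have h2 : 2 * (M : ℝ) ≤ M * (2 * D) := by nlinarith
    have h3 : u * N ≤ μ ^ 2 * N := by nlinarith
    linarith
  have hsq : Real.sqrt ((N + 2 * M : ℕ) : ℝ) ≤ Real.sqrt (1 + μ ^ 2) * Real.sqrt N := by
    rw [← Real.sqrt_mul (by positivity)]
    refine Real.sqrt_le_sqrt ?_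
    push_cast; nlinarith
  have hlem : (M : ℝ) * Real.log (1 + u / (2 * μ ^ 2)) ≤ c'' * Real.sqrt N := by
    have := mul_le_mul_of_nonneg_left hsq hc'0
    rw [hc'']; nlinarith
  obtain ⟨x, hx⟩ : ∃ x : ℝ, x = u / (2 * μ ^ 2) := ⟨_, rfl⟩
  have hx0 : 0 < x := by rw [hx]; positivity
  rw [← hx] at hlem
  -- `t = N^{1/4}`, `t² = √N ≥ 1`
  obtain ⟨t, ht⟩ : ∃ t : ℝ, t = (N : ℝ) ^ ((1 : ℝ) / 4) := ⟨_, rfl⟩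
  have ht0 : 0 < t := by rw [ht]; exact Real.rpow_pos_of_pos hN0 _
  have ht1 : 1 ≤ t := by rw [ht]; exact Real.one_le_rpow hNr (by norm_num)
  have ht2 : t ^ 2 = Real.sqrt N := by
    rw [ht, ← Real.rpow_natCast, ← Real.rpow_mul hN0.le, Real.sqrt_eq_rpow]; norm_num
  have hsN0 : 0 < Real.sqrt N := Real.sqrt_pos.2 hN0
  rw [← ht]
  by_cases hx1 : 1 ≤ x
  · -- large deviation
    have hlog2 : (1 : ℝ) / 2 ≤ Real.log (1 + x) := by
      have h1 : Real.log 2 ≤ Real.log (1 + x) := Real.log_le_log (by norm_num) (by linarith)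
      have h2 : (1 : ℝ) / 2 ≤ Real.log 2 := by have := Real.log_two_gt_d9; linarith
      linarith
    have hM2' : (M : ℝ) ≤ 2 * c'' * Real.sqrt N := by
      have := mul_le_mul_of_nonneg_left hlog2 (Nat.cast_nonneg M)
      linarith [hlem]
    have hsN1 : 1 ≤ Real.sqrt N := by rw [← ht2]; exact one_le_pow₀ ht1
    have h3 : u * N ≤ 2 * D * (2 * c'' + 1) * Real.sqrt N := by
      have h1 : u * N / (2 * D) ≤ (2 * c'' + 1) * Real.sqrt N := by linarith
      rw [div_le_iff₀ (by positivity)] at h1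
      linarith
    have h4 : u * Real.sqrt N ≤ 2 * D * (2 * c'' + 1) := by
      refine le_of_mul_le_mul_right ?_ hsN0
      rw [mul_assoc, Real.mul_self_sqrt hN0.le]; exact h3
    have h5 : u * t ≤ u * Real.sqrt N := by
      rw [← ht2]; exact mul_le_mul_of_nonneg_left (by nlinarith) hu.le
    have h6 : 0 ≤ Real.sqrt (8 * μ ^ 2 * D * (c'' + 1)) := Real.sqrt_nonneg _
    exact h5.trans (h4.trans (le_add_of_nonneg_left h6))
  · -- small deviation
    rw [not_le] at hx1
    have hlogx := half_le_log_one_add' hx0.le hx1.le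
    have hMx : (M : ℝ) * x ≤ 2 * c'' * Real.sqrt N := by
      have := mul_le_mul_of_nonneg_left hlogx (Nat.cast_nonneg M)
      linarith [hlem]
    have h3 : (u * N / (2 * D) - 1) * x ≤ 2 * c'' * Real.sqrt N := by
      have := mul_le_mul_of_nonneg_right hMge hx0.le; linarith
    have hd1 : u * N / (2 * D) * (2 * D) = u * N := div_mul_cancel₀ _ (by positivity)
    have hd2 : x * (2 * μ ^ 2) = u := by rw [hx]; exact div_mul_cancel₀ _ (by positivity)
    have e2 : (u * N / (2 * D) - 1) * x * (4 * μ ^ 2 * D) = u ^ 2 * N - 4 * μ ^ 2 * D * x := by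
      linear_combination (2 * μ ^ 2 * x) * hd1 + (u * N) * hd2
    have h4 : u ^ 2 * N - 4 * μ ^ 2 * D * x ≤ 2 * c'' * Real.sqrt N * (4 * μ ^ 2 * D) := by
      have := mul_le_mul_of_nonneg_right h3 (show (0:ℝ) ≤ 4 * μ ^ 2 * D by positivity)
      rwa [e2] at this
    have h5 : 4 * μ ^ 2 * D * x ≤ 8 * μ ^ 2 * D * Real.sqrt N := by
      have hsN1 : 1 ≤ Real.sqrt N := by rw [← ht2]; exact one_le_pow₀ ht1
      have : x ≤ 2 * Real.sqrt N := by linarith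
      have h0 : 0 ≤ 4 * μ ^ 2 * D := by positivity
      calc 4 * μ ^ 2 * D * x ≤ 4 * μ ^ 2 * D * (2 * Real.sqrt N) := mul_le_mul_of_nonneg_left this h0
        _ = 8 * μ ^ 2 * D * Real.sqrt N := by ring
    have h7 : u ^ 2 * N ≤ 8 * μ ^ 2 * D * (c'' + 1) * Real.sqrt N := by linarith
    have h6 : u ^ 2 * Real.sqrt N ≤ 8 * μ ^ 2 * D * (c'' + 1) := by
      refine le_of_mul_le_mul_right ?_ hsN0
      rw [mul_assoc, Real.mul_self_sqrt hN0.le]; exact h7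
    have h8 : (u * t) ^ 2 ≤ 8 * μ ^ 2 * D * (c'' + 1) := by rw [mul_pow, ht2]; exact h6
    have h9 : u * t ≤ Real.sqrt (8 * μ ^ 2 * D * (c'' + 1)) :=
      (Real.le_sqrt (by positivity) (by positivity)).2 h8
    have h10 : 0 ≤ 2 * D * (2 * c'' + 1) := by positivity
    exact h9.trans (le_add_of_nonneg_right h10)

/-! ### The lower routine with mixed supermultiplicativity -/

/-- **Lower deviation with mixed supermultiplicativity**: if `φ_{N'+2M} ≤ μ² − u` (`0 < u ≤ μ²`, `N' ≥ N₁`,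
`N' ≥ 1`) and `2 M D ≤ u N'` then backward iteration keeps `φ ≤ μ² − u/2` on `[N', N'+2M]`, so
`b₀(2M) a(N') ≤ a(N'+2M) ≤ (μ² − u/2)^M a(N')` against `b₀(2M) ≥ e^{-c√(2M)} μ^{2M}`:
`-M log(1 − u/(2μ²)) ≤ c √(2M)`. [cite: MadrasSlade1993, Lemma 7.3.1 (proof, quantitative form)] -/
theorem lower_dev_mixed {b b₀ : ℕ → ℝ} {μ D c u : ℝ} {N₁ N' M : ℕ} (hb : ∀ n, 0 < b n) (hμ : 0 < μ)
    (hD : 0 ≤ D) (hK : ∀ n : ℕ, N₁ ≤ n → b (n + 2) / b n - D / n ≤ b (n + 4) / b (n + 2))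
    (hmix : ∀ m n : ℕ, b₀ m * b n ≤ b (m + n))
    (hlo : Real.exp (-(c * Real.sqrt ((2 * M : ℕ) : ℝ))) * μ ^ (2 * M) ≤ b₀ (2 * M))
    (hN' : N₁ ≤ N') (hN'1 : 1 ≤ N') (hu : 0 < u) (huμ : u ≤ μ ^ 2)
    (hdev : b (N' + 2 * M + 2) / b (N' + 2 * M) ≤ μ ^ 2 - u) (hM : 2 * (M : ℝ) * D ≤ u * N') :
    -((M : ℝ) * Real.log (1 - u / (2 * μ ^ 2))) ≤ c * Real.sqrt ((2 * M : ℕ) : ℝ) := by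
  have hN0 : (0 : ℝ) < N' := by exact_mod_cast hN'1
  set q : ℝ := μ ^ 2 - u / 2 with hq
  have hq0 : 0 < q := by rw [hq]; nlinarith
  have hK' : ∀ n : ℕ, N₁ ≤ n → (fun n => b (n + 2) / b n) n - D / n ≤ (fun n => b (n + 2) / b n) (n + 2) := by
    intro n hn; simpa [add_assoc] using hK n hn
  have hiter := kesten_iter_backward (φ := fun n => b (n + 2) / b n) (N₁ := N₁) hD hK'
  have hMD : (M : ℝ) * D / N' ≤ u / 2 := by
    rw [div_le_iff₀ hN0]; linarith
  have hstep : ∀ j < M, b (N' + 2 * j + 2) / b (N' + 2 * j) ≤ q := by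
    intro j hj
    have h1 := hiter (M - j) (N' + 2 * j) (by omega) (by omega)
    have e : N' + 2 * j + 2 * (M - j) = N' + 2 * M := by omega
    rw [e] at h1
    have h2 : ((M - j : ℕ) : ℝ) * D / ((N' + 2 * j : ℕ) : ℝ) ≤ M * D / N' := by
      have hMj : ((M - j : ℕ) : ℝ) ≤ M := by exact_mod_cast Nat.sub_le M j
      have hden : (N' : ℝ) ≤ ((N' + 2 * j : ℕ) : ℝ) := by exact_mod_cast Nat.le_add_right N' (2 * j)
      calc ((M - j : ℕ) : ℝ) * D / ((N' + 2 * j : ℕ) : ℝ) ≤ M * D / ((N' + 2 * j : ℕ) : ℝ) :=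
            div_le_div_of_nonneg_right (mul_le_mul_of_nonneg_right hMj hD) (by positivity)
        _ ≤ M * D / N' := div_le_div_of_nonneg_left (by positivity) hN0 hden
    have e1 : b (N' + 2 * j + 2) / b (N' + 2 * j) = (fun n => b (n + 2) / b n) (N' + 2 * j) := rfl
    have e2 : b (N' + 2 * M + 2) / b (N' + 2 * M) = (fun n => b (n + 2) / b n) (N' + 2 * M) := rfl
    rw [e1]; rw [e2] at hdev
    linarith
  have hprod := kesten_prod_le hb (n := N') (M := M) hstep
  -- `e^{-c√(2M)} μ^{2M} a_{N'} ≤ b₀_{2M} a_{N'} ≤ a_{2M+N'} = a_{N'+2M} ≤ q^M a_{N'}`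
  have h1 : b N' * (Real.exp (-(c * Real.sqrt ((2 * M : ℕ) : ℝ))) * μ ^ (2 * M)) ≤ q ^ M * b N' :=
    calc b N' * (Real.exp (-(c * Real.sqrt ((2 * M : ℕ) : ℝ))) * μ ^ (2 * M)) ≤ b N' * b₀ (2 * M) :=
          mul_le_mul_of_nonneg_left hlo (hb N').le
      _ = b₀ (2 * M) * b N' := mul_comm _ _
      _ ≤ b (2 * M + N') := hmix (2 * M) N'
      _ = b (N' + 2 * M) := by rw [add_comm]
      _ ≤ q ^ M * b N' := hprod
  have h2 : Real.exp (-(c * Real.sqrt ((2 * M : ℕ) : ℝ))) ≤ (q / μ ^ 2) ^ M := by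
    rw [div_pow, ← pow_mul, le_div_iff₀ (by positivity)]
    have h1' : Real.exp (-(c * Real.sqrt ((2 * M : ℕ) : ℝ))) * μ ^ (2 * M) * b N' ≤ q ^ M * b N' := by
      rw [mul_comm] at h1; simpa [mul_assoc, mul_comm, mul_left_comm] using h1
    exact le_of_mul_le_mul_right h1' (hb N')
  have hr : q / μ ^ 2 = 1 - u / (2 * μ ^ 2) := by rw [hq]; field_simp
  have hr0 : 0 < q / μ ^ 2 := by positivity
  have h3 := Real.log_le_log (Real.exp_pos _) h2
  rw [Real.log_exp, Real.log_pow, hr] at h3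
  linarith

/-- **Lower routine with mixed supermultiplicativity**: a deviation `φ_N ≤ μ² − v` with `0 < v ≤ min(μ², D)`
at `N ≥ 2N₁ + 2` forces `v³ N ≤ 32 c² μ⁴ D + 4 D³` (`b₀(m) a(n) ≤ a(m+n)`, `b₀(n) ≥ e^{-c√n} μ^n`).
[cite: MadrasSlade1993, Lemma 7.3.1 (proof, quantitative form)] -/
theorem lower_rate_core_mixed {b b₀ : ℕ → ℝ} {μ D c v : ℝ} {N₁ N : ℕ} (hb : ∀ n, 0 < b n) (hμ : 0 < μ)
    (hD1 : 1 ≤ D)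
    (hK : ∀ n : ℕ, N₁ ≤ n → b (n + 2) / b n - D / n ≤ b (n + 4) / b (n + 2))
    (hmix : ∀ m n : ℕ, b₀ m * b n ≤ b (m + n))
    (hlo : ∀ n : ℕ, Real.exp (-(c * Real.sqrt n)) * μ ^ n ≤ b₀ n)
    (hN : 2 * N₁ + 2 ≤ N) (hv : 0 < v) (hvμ : v ≤ μ ^ 2) (hvD : v ≤ D)
    (hdev : b (N + 2) / b N ≤ μ ^ 2 - v) : v ^ 3 * N ≤ 32 * c ^ 2 * μ ^ 4 * D + 4 * D ^ 3 := by
  have hD : 0 ≤ D := by linarith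
  have hD0 : 0 < D := by linarith
  have hN0 : (0 : ℝ) < N := by exact_mod_cast (show 0 < N by omega)
  obtain ⟨M, hMdef⟩ : ∃ M : ℕ, M = Nat.floor (v * N / (4 * D)) := ⟨_, rfl⟩
  have hMle : (M : ℝ) ≤ v * N / (4 * D) := by rw [hMdef]; exact Nat.floor_le (by positivity)
  have hMge : v * N / (4 * D) - 1 ≤ M := by
    have := Nat.lt_floor_add_one (v * N / (4 * D)); rw [← hMdef] at this; linarith
  have hM4 : 4 * (M : ℝ) ≤ N := by
    have h1 : v * N / (4 * D) ≤ N / 4 := by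
      rw [div_le_div_iff₀ (by positivity) (by norm_num)]; nlinarith
    linarith
  have hM4' : 4 * M ≤ N := by exact_mod_cast hM4
  obtain ⟨N', hN'def⟩ : ∃ N' : ℕ, N' = N - 2 * M := ⟨_, rfl⟩
  have hN'eq : N' + 2 * M = N := by omega
  have hN'ge : N₁ ≤ N' := by omega
  have hN'1 : 1 ≤ N' := by omega
  have hN'half : (N : ℝ) ≤ 2 * N' := by exact_mod_cast (show N ≤ 2 * N' by omega)
  have hdev' : b (N' + 2 * M + 2) / b (N' + 2 * M) ≤ μ ^ 2 - v := by rw [hN'eq]; exact hdev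
  have hMD : 2 * (M : ℝ) * D ≤ v * N' := by
    have h1 : (M : ℝ) * (4 * D) ≤ v * N := by rwa [le_div_iff₀ (by positivity)] at hMle
    nlinarith
  have hlem := lower_dev_mixed (N₁ := N₁) hb hμ hD hK hmix (hlo (2 * M)) hN'ge hN'1 hv hvμ hdev' hMD
  -- `x = v/(2μ²) ≤ 1/2`, `M x ≤ c √(2M)`, `M x² ≤ 2 c²`
  obtain ⟨x, hx⟩ : ∃ x : ℝ, x = v / (2 * μ ^ 2) := ⟨_, rfl⟩
  have hx0 : 0 < x := by rw [hx]; positivity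
  have hx1 : x ≤ 1 / 2 := by rw [hx, div_le_div_iff₀ (by positivity) (by norm_num)]; nlinarith
  have hlogx := le_neg_log_one_sub' (show x < 1 by linarith)
  have hMx : (M : ℝ) * x ≤ c * Real.sqrt ((2 * M : ℕ) : ℝ) := by
    have h1 := mul_le_mul_of_nonneg_left hlogx (Nat.cast_nonneg M)
    rw [hx] at h1 ⊢
    linarith
  have hM2 : (M : ℝ) * x ^ 2 ≤ 2 * c ^ 2 := by
    rcases Nat.eq_zero_or_pos M with hM0 | hMpos
    · rw [hM0, Nat.cast_zero, zero_mul]; positivity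
    have hMr : (0 : ℝ) < M := by exact_mod_cast hMpos
    have hsq : ((M : ℝ) * x) ^ 2 ≤ (c * Real.sqrt ((2 * M : ℕ) : ℝ)) ^ 2 :=
      pow_le_pow_left₀ (by positivity) hMx 2
    rw [mul_pow, mul_pow, Real.sq_sqrt (by positivity)] at hsq
    push_cast at hsq
    nlinarith
  have hxμ : x * (2 * μ ^ 2) = v := by rw [hx]; exact div_mul_cancel₀ _ (by positivity)
  have e : (M : ℝ) * x ^ 2 * (4 * μ ^ 4) = M * v ^ 2 := by
    linear_combination ((M : ℝ) * (x * (2 * μ ^ 2) + v)) * hxμ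
  have hM2' : (M : ℝ) * v ^ 2 ≤ 8 * c ^ 2 * μ ^ 4 := by
    have := mul_le_mul_of_nonneg_right hM2 (show (0:ℝ) ≤ 4 * μ ^ 4 by positivity)
    rw [e] at this; linarith
  have h3 : (v * N / (4 * D) - 1) * v ^ 2 ≤ 8 * c ^ 2 * μ ^ 4 := by
    have := mul_le_mul_of_nonneg_right hMge (sq_nonneg v); linarith
  have hd4 : v * N / (4 * D) * (4 * D) = v * N := div_mul_cancel₀ _ (by positivity)
  have e2 : (v * N / (4 * D) - 1) * v ^ 2 * (4 * D) = v ^ 3 * N - 4 * D * v ^ 2 := by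
    linear_combination (v ^ 2) * hd4
  have h4 : v ^ 3 * N - 4 * D * v ^ 2 ≤ 8 * c ^ 2 * μ ^ 4 * (4 * D) := by
    have := mul_le_mul_of_nonneg_right h3 (show (0:ℝ) ≤ 4 * D by positivity)
    rwa [e2] at this
  have h5 : 4 * D * v ^ 2 ≤ 4 * D ^ 3 := by
    have := pow_le_pow_left₀ hv.le hvD 2; nlinarith
  linarith

end Literature.Probability.RandomPlanarGeometry.SAW.Zd

end
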